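/-
Copyright: the b2b-balaban T⁴-continuum CRUX team, row NE7b leaf lineage `t4-ne7b-formalise-leaf-03` (gen 155; v1.2 = v1.1 + chair G-1). Project licence.
-/
import Summits.QuantumFields.BalabanUV.T4Continuum.Spine.NE7b.SupSmallFieldBackground
import Summits.QuantumFields.BalabanUV.T4Continuum.Spine.NE7b.SupBackgroundPeriodic
import Summits.QuantumFields.BalabanUV.T4Continuum.Spine.NE7b.PeriodicSupTorusCarrier

/-!
# THE SMALL-FIELD BACKGROUND ON EVERY TORUS: (60)'s background configuration `σ(w)` of the perturbed scalar skeleton, restricted to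
# `s`-periodic coarse fields, IS a map of torus carriers `σt : ((ℤ∕s)^d → ℝ) → ((ℤ∕(n+1)s)^d → ℝ)`, `σt wt = σ(Ec wt) ∘ windowMap`,
# with the SAME letters — radius `(N⁻¹ − c)·r ↦ r`, torus block means `wt`, the sitewise background equation, Lipschitz constant
# `(N⁻¹ − c)⁻¹`, uniqueness among torus fields of norm `≤ r` — (60) + (73) moved onto the `Fintype` carriers by PTC's isometries
# (row NE7b, node U5c; (60) `exists_background`, (73) `background_periodic_of_letters`, PTC BY NAME; [folklore])

Cell `pub-balaban`, sub-cell `t4`, spine estimate NE7b (`T4WeightBudget.RelWeightBound`; the cell's OWN estimate — NOT PRINTED in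
[Bałaban 1983–89], NOT PROVED).  Crux-route work under `Spine/NE7b/` by a row leaf (`t4-ne7b-formalise-leaf-03` gen 155) under
FREEZE (0)'s crux-prover clause, OFFER O-leaf03-g155-1 to the row OWNER (`t4-ne7b-p1` g115, W-ne7bp1-g115-10 (a): «with (73)∕(74)
landed the interacting background transfers the same way»); NOTHING of Bałaban's is named as a Lean object, valued or asserted; no
`T4Continuum/Support` leaf typed; no `def`, no notation (`σt` is delivered inside `∃ …` with its action `σt wt = Rf (σ (Ec wt))`
DISPLAYED); zero `sorry`.  Imports (BY NAME): the OWNER's (60) `…SupSmallFieldBackground` (`exists_background`) and (73)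
`…SupBackgroundPeriodic` (`background_periodic_of_letters`; OWNER W-ne7bp1-g115-11 GO), (72) `…AugmentedInversePeriodic` (`blockAvg_periodic`),
and this lineage's PTC `…PeriodicSupTorusCarrier` (`exists_clm_periodise`, `exists_clm_restrict`, `norm_periodise`,
`restrict_periodise`, `periodise_restrict_of_periodic`, `norm_restrict_of_periodic`, `periodise_periodic`, `natCast_mul_smul_eq`).

WHAT IS PROVED ([folklore]; `ℓ^∞ := lp (fun _ : X d => ℝ) ∞`; fine torus `Site d ((n+1)·s)`, coarse torus `Site d s`, `[NeZero s]`):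
* §1 `sub_periodic`, **`torus_blockAvg_apply`** (the torus block mean DISPLAYED: `Rc (Q′(Ef ht)) x = ((n+1)^d)⁻¹ Σ_{p ∈ B n (windowMap x)}
  ht (siteOf p)`), `blockAvg_periodise_periodic` (`Q′(Ef ht)` is `s`-periodic; (72) `blockAvg_periodic`), `norm_restrict_le`, and
  **`torus_operator_of_periodic`** (ANY `S : ℓ^∞ →L ℓ^∞` sending `N`-periodic to `M`-periodic fields: `St := Rm ∘ S ∘ En` has
  `Em (St g) = S (En g)` and `‖St‖ ≤ ‖S‖` — the pattern for `Q′ ∕ A ∕ P` and, with (73) §4, for `Dσ(w)` ∕ `C̃(w)`).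
* §2 GENERIC IN `σ` (any radii `R₀ ∕ r`, any Lipschitz constant; `σt wt = Rf (σ (Ec wt))`): **`background_torus_of_letters`** — from the
  closed-ball letter (`‖σ w‖ ≤ r`, `Q′(σ w) = w`, sitewise equation on `‖w‖ ≤ R₀`) and the PERIODICITY letter in (73) §3's shape, on
  the torus ball `‖wt‖ ≤ R₀`: `‖σt wt‖ ≤ r`, **`Ef (σt wt) = σ (Ec wt)`**, `Q′(Ef (σt wt)) = Ec wt`, `Rc (Q′(Ef (σt wt))) = wt`, the
  sitewise equation for `Ef (σt wt)`; **`background_torus_lipschitz`** — `LipschitzOnWith K σ` ⟹ `LipschitzOnWith K σt` (PTC's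
  isometries).  The periodicity letter is supplied by (73) `background_periodic_of_letters` (uniqueness-based, §4 here) or by (74)
  `SupBackgroundUniqueness.background_periodic` (`2λC_Γ(0) < 1`, e.g. for (63)'s localised `σ` — the OWNER's located note (i)).
* §3 torus UNIQUENESS from either `ℓ^∞` letter: **`torus_unique_of_section_letter`** ((60)'s `σ(Q′φ) = φ`: a torus field `φt`,
  `‖φt‖ ≤ r`, whose periodisation solves the equation IS `σt (Rc (Q′(Ef φt)))`) and **`torus_unique_of_sitewise_letter`** ((74)'s
  `eq_of_sitewise` shape: a torus solution with block means `Ec wt` IS `σt wt`).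
* §4 instance **`exists_background_torus`** (`d ≥ 3`, (60)'s binders VERBATIM, every `s ≥ 1`): (60) `exists_background`'s
  `Q′ ∕ A ∕ P ∕ σ` with their displayed actions and ALL letters (incl. the derivative clause — chair leaf-04 g164's G-1) RE-EXPORTED for
  the same witnesses, the four PTC carrier maps with actions and laws, and `σt` with `σt wt = Rf (σ (Ec wt))`, `σt 0 = 0`, the §2 conclusions on `‖wt‖ ≤ (N⁻¹ − c)·r`, `LipschitzOnWith (N⁻¹ − c)⁻¹ σt`,
  and §3's uniqueness — periodicity discharged by (73).  §5 toy.

HONEST (what this is NOT).  Carrier bookkeeping: the analysis is (60)'s and (73)'s, constants (60)'s (existential ∕ useless by value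
at small sides); cubic periods; the derivative ∕ covariance clauses of (60) and the linearised clause of (73) are NOT transferred here
((73) `linearised_periodic_of_letters` feeds `torus_operator_of_periodic` — the OWNER's note (ii), instances in a sibling); the (63)-instance waits for (74)
`background_periodic` ✓ (one application of §2 ∕ §3); scalar skeleton, not the covariant operators ((A3), NC-NE7b-α UNRULED); nothing of Bałaban's.
BY-NAME EFFECT ON THE WALL: NONE.  NE7b NOT PRINTED ∕ NOT PROVED; spine PROVED 0∕9; rung (B)+1 on a FINITE torus — NOT infinite volume,
NOT the mass gap, NOT Clay.  HONEST DEPENDENCY: continuum YM on T⁴ ⇐ BetaPertH ∧ nine spine estimates (0∕9 proved); BetaPertH ⇐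
(D1) ∧ (D4) ∧ CAP+tail; G-an2-4 gates asym, D1 and NE2∕3∕4.
-/

set_option autoImplicit false

noncomputable section

namespace Summit.QuantumFields.BalabanUV.T4Continuum.NE7b.SupBackgroundTorusCarrier

open Set Metric
open scoped ENNReal NNReal
open Literature.MathematicalPhysics.QuantumFieldTheory.Balaban1983to89
open B4Sect5Proof (latticeConst)
open B6QGQLower276 (X blk B side AX)
open B6QGQDecay237 (deltaU)
open B5Hk103ScalarZd (nbhd deltaH)
open Summit.QuantumFields.BalabanUV.Beta.D1BFx.BlockColumnSupNorm (cHs)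
open Summit.QuantumFields.BalabanUV.Beta.D1BFx.PointColumnSplit (cKL cG0 cSplit)
open Summit.QuantumFields.BalabanUV.Beta.D1BFx.PointColumnDecay (cFar)
open Beta (Site siteOf windowMap)
open SupSmallFieldBackground (exists_background)
open SupBackgroundPeriodic (background_periodic_of_letters)
open AugmentedInversePeriodic (blockAvg_periodic)
open PeriodicSupTorusCarrier (exists_clm_periodise exists_clm_restrict norm_periodise restrict_periodise
  periodise_restrict_of_periodic norm_restrict_of_periodic periodise_periodic natCast_mul_smul_eq)

variable {d : ℕ}

/-! ## §1. Small bookkeeping: periodic differences, the displayed torus block mean -/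

/-- A difference of two `ℓ^∞` fields with the same period has that period. [folklore] -/
theorem sub_periodic {c : X d} {f g : lp (fun _ : X d => ℝ) ∞} (hf : ∀ q t : X d, f (q + c • t) = f q)
    (hg : ∀ q t : X d, g (q + c • t) = g q) (q t : X d) : (f - g) (q + c • t) = (f - g) q := by
  rw [lp.coeFn_sub, Pi.sub_apply, Pi.sub_apply, hf, hg]

/-- **THE TORUS BLOCK MEAN, DISPLAYED**: for `Dop` with the block-average action and carrier maps `Ef` (fine) ∕ `Rc` (coarse) with their
displayed actions, `Rc (Dop (Ef ht)) x = ((n+1)^d)⁻¹ Σ_{p ∈ B n (windowMap x)} ht (siteOf p)` — the mean of the torus field over the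
torus block of `x`, read through window representatives. [folklore] -/
theorem torus_blockAvg_apply (n : ℕ) {N s : ℕ} [NeZero s]
    {Dop : lp (fun _ : X d => ℝ) ∞ →L[ℝ] lp (fun _ : X d => ℝ) ∞}
    (hD : ∀ (f : lp (fun _ : X d => ℝ) ∞) (y : X d), Dop f y = (((n : ℝ) + 1) ^ d)⁻¹ * ∑ p ∈ B n y, f p)
    {Ef : (Site d N → ℝ) →L[ℝ] lp (fun _ : X d => ℝ) ∞} {Rc : lp (fun _ : X d => ℝ) ∞ →L[ℝ] (Site d s → ℝ)}
    (hEf : ∀ (g : Site d N → ℝ) (q : X d), Ef g q = g (siteOf d N q))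
    (hRc : ∀ (h : lp (fun _ : X d => ℝ) ∞) (x : Site d s), Rc h x = h (windowMap d s x))
    (ht : Site d N → ℝ) (x : Site d s) :
    Rc (Dop (Ef ht)) x = (((n : ℝ) + 1) ^ d)⁻¹ * ∑ p ∈ B n (windowMap d s x), ht (siteOf d N p) := by
  rw [hRc, hD]
  exact congrArg _ (Finset.sum_congr rfl fun p _ => hEf ht p)

/-- The block means of a periodised fine torus field are `s`-periodic ((72) `blockAvg_periodic`). [folklore] -/
theorem blockAvg_periodise_periodic (n s : ℕ) {Dop : lp (fun _ : X d => ℝ) ∞ →L[ℝ] lp (fun _ : X d => ℝ) ∞}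
    (hD : ∀ (f : lp (fun _ : X d => ℝ) ∞) (y : X d), Dop f y = (((n : ℝ) + 1) ^ d)⁻¹ * ∑ p ∈ B n y, f p)
    {Ef : (Site d ((n + 1) * s) → ℝ) →L[ℝ] lp (fun _ : X d => ℝ) ∞}
    (hEf : ∀ (g : Site d ((n + 1) * s) → ℝ) (q : X d), Ef g q = g (siteOf d ((n + 1) * s) q))
    (ht : Site d ((n + 1) * s) → ℝ) (y t : X d) : Dop (Ef ht) (y + (s : ℤ) • t) = Dop (Ef ht) y := by
  rw [hD, hD]
  exact blockAvg_periodic n s (fun q t' => by rw [← natCast_mul_smul_eq]; exact periodise_periodic hEf ht q t') y t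

/-- `‖R h‖ ≤ ‖h‖` for ANY window restriction with the displayed action (each window value is a value of `h`). [folklore] -/
theorem norm_restrict_le {N : ℕ} [NeZero N] {R : lp (fun _ : X d => ℝ) ∞ →L[ℝ] (Site d N → ℝ)}
    (hR : ∀ (h : lp (fun _ : X d => ℝ) ∞) (x : Site d N), R h x = h (windowMap d N x)) (h : lp (fun _ : X d => ℝ) ∞) :
    ‖R h‖ ≤ ‖h‖ :=
  (pi_norm_le_iff_of_nonneg (norm_nonneg h)).2 fun x => by rw [hR]; exact lp.norm_apply_le_norm ENNReal.top_ne_zero h _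

/-- **ANY OPERATOR OF `ℓ^∞` THAT SENDS `N`-PERIODIC FIELDS TO `M`-PERIODIC FIELDS IS AN OPERATOR OF TORUS CARRIERS WITH THE SAME NORM**:
`St := Rm ∘ S ∘ En : (Site d N → ℝ) →L (Site d M → ℝ)` has `Em (St g) = S (En g)` (its periodisation IS `S` of the periodisation) and
`‖St‖ ≤ ‖S‖` — the transfer pattern for the response `Dσ(w)` and the covariance `C̃(w)` ((73) `linearised_periodic_of_letters` supplies
the periodicity hypothesis; the OWNER's note (ii)), and for `Q′ ∕ A ∕ P` themselves ((72) §1). [folklore] -/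
theorem torus_operator_of_periodic {N M : ℕ} [NeZero N] [NeZero M] (S : lp (fun _ : X d => ℝ) ∞ →L[ℝ] lp (fun _ : X d => ℝ) ∞)
    (hS : ∀ h : lp (fun _ : X d => ℝ) ∞, (∀ q t : X d, h (q + (N : ℤ) • t) = h q) →
      ∀ q t : X d, S h (q + (M : ℤ) • t) = S h q)
    {En : (Site d N → ℝ) →L[ℝ] lp (fun _ : X d => ℝ) ∞} {Em : (Site d M → ℝ) →L[ℝ] lp (fun _ : X d => ℝ) ∞}
    {Rm : lp (fun _ : X d => ℝ) ∞ →L[ℝ] (Site d M → ℝ)}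
    (hEn : ∀ (g : Site d N → ℝ) (q : X d), En g q = g (siteOf d N q))
    (hEm : ∀ (g : Site d M → ℝ) (q : X d), Em g q = g (siteOf d M q))
    (hRm : ∀ (h : lp (fun _ : X d => ℝ) ∞) (x : Site d M), Rm h x = h (windowMap d M x)) :
    (∀ g, Em (((Rm.comp S).comp En) g) = S (En g)) ∧ ‖(Rm.comp S).comp En‖ ≤ ‖S‖ := by
  refine ⟨fun g => ?_, ContinuousLinearMap.opNorm_le_bound _ (norm_nonneg S) fun g => ?_⟩
  · rw [ContinuousLinearMap.comp_apply, ContinuousLinearMap.comp_apply]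
    exact periodise_restrict_of_periodic hEm hRm (hS (En g) (periodise_periodic hEn g))
  · rw [ContinuousLinearMap.comp_apply, ContinuousLinearMap.comp_apply]
    refine (norm_restrict_le hRm _).trans ((S.le_opNorm _).trans (le_of_eq ?_))
    rw [norm_periodise hEn]

/-! ## §2. Transfer of ANY background map with the displayed letters (generic in `σ`, radii, Lipschitz constant) -/

section Generic

variable {n s : ℕ} [NeZero s] {a : ℝ} {Dop Aop : lp (fun _ : X d => ℝ) ∞ →L[ℝ] lp (fun _ : X d => ℝ) ∞}
  {u : ℝ → ℝ} {σ : lp (fun _ : X d => ℝ) ∞ → lp (fun _ : X d => ℝ) ∞} {R₀ r : ℝ}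
  {Ef : (Site d ((n + 1) * s) → ℝ) →L[ℝ] lp (fun _ : X d => ℝ) ∞} {Rf : lp (fun _ : X d => ℝ) ∞ →L[ℝ] (Site d ((n + 1) * s) → ℝ)}
  {Ec : (Site d s → ℝ) →L[ℝ] lp (fun _ : X d => ℝ) ∞} {Rc : lp (fun _ : X d => ℝ) ∞ →L[ℝ] (Site d s → ℝ)}
  {σt : (Site d s → ℝ) → (Site d ((n + 1) * s) → ℝ)}

/-- **ANY BACKGROUND MAP WITH THE DISPLAYED LETTERS TRANSFERS TO THE TORUS CARRIERS.**  Let `σ : ℓ^∞ → ℓ^∞` satisfy, on the coarse ball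
`‖w‖ ≤ R₀`, the closed-ball letter (`‖σ w‖ ≤ r`, block means `Q′(σ w) = w`, the sitewise background equation) and the PERIODICITY letter
in (73) §3's shape (an `s`-periodic `w` has a `side n • (s • t)`-periodic background — (73) `background_periodic_of_letters` from a
uniqueness letter, or (74) `background_periodic` from `2λC_Γ(0) < 1`), and let `Ef ∕ Rf`, `Ec ∕ Rc` be PTC carrier maps and
`σt wt = Rf (σ (Ec wt))`.  Then on the torus ball `‖wt‖ ≤ R₀`: `‖σt wt‖ ≤ r`, `Ef (σt wt) = σ (Ec wt)`, `Q′(Ef (σt wt)) = Ec wt`,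
`Rc (Q′(Ef (σt wt))) = wt`, and the sitewise equation holds for `Ef (σt wt)`. [folklore] -/
theorem background_torus_of_letters
    (hσ : ∀ w ∈ closedBall (0 : lp (fun _ : X d => ℝ) ∞) R₀,
      σ w ∈ closedBall 0 r ∧ Dop (σ w) = w ∧
        ∀ p : X d, Aop (σ w) p + u (σ w p)
          = (((n : ℝ) + 1) ^ d)⁻¹ * ∑ p' ∈ B n (blk n p), (Aop (σ w) p' + u (σ w p')))
    (hperσ : ∀ w ∈ closedBall (0 : lp (fun _ : X d => ℝ) ∞) R₀, (∀ y t : X d, w (y + (s : ℤ) • t) = w y) →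
      ∀ q t : X d, σ w (q + side n • ((s : ℤ) • t)) = σ w q)
    (hEf : ∀ (g : Site d ((n + 1) * s) → ℝ) (q : X d), Ef g q = g (siteOf d ((n + 1) * s) q))
    (hRf : ∀ (h : lp (fun _ : X d => ℝ) ∞) (x : Site d ((n + 1) * s)), Rf h x = h (windowMap d ((n + 1) * s) x))
    (hEc : ∀ (g : Site d s → ℝ) (q : X d), Ec g q = g (siteOf d s q))
    (hRc : ∀ (h : lp (fun _ : X d => ℝ) ∞) (x : Site d s), Rc h x = h (windowMap d s x))
    (hσt : ∀ wt, σt wt = Rf (σ (Ec wt)))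
    (wt : Site d s → ℝ) (hwt : wt ∈ closedBall (0 : Site d s → ℝ) R₀) :
    σt wt ∈ closedBall 0 r ∧ Ef (σt wt) = σ (Ec wt) ∧ Dop (Ef (σt wt)) = Ec wt ∧ Rc (Dop (Ef (σt wt))) = wt ∧
      ∀ p : X d, Aop (Ef (σt wt)) p + u (Ef (σt wt) p)
        = (((n : ℝ) + 1) ^ d)⁻¹ * ∑ p' ∈ B n (blk n p), (Aop (Ef (σt wt)) p' + u (Ef (σt wt) p')) := by
  have hball : Ec wt ∈ closedBall (0 : lp (fun _ : X d => ℝ) ∞) R₀ := by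
    rw [mem_closedBall_zero_iff] at hwt ⊢
    rwa [norm_periodise hEc]
  obtain ⟨hσball, hDσ, hEq⟩ := hσ (Ec wt) hball
  have hper : ∀ q t : X d, σ (Ec wt) (q + (((n + 1) * s : ℕ) : ℤ) • t) = σ (Ec wt) q := fun q t => by
    rw [natCast_mul_smul_eq]; exact hperσ (Ec wt) hball (periodise_periodic hEc wt) q t
  have hE : Ef (σt wt) = σ (Ec wt) := by rw [hσt]; exact periodise_restrict_of_periodic hEf hRf hper
  refine ⟨?_, hE, by rw [hE, hDσ], by rw [hE, hDσ, restrict_periodise hEc hRc], fun p => by rw [hE]; exact hEq p⟩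
  rw [mem_closedBall_zero_iff] at hσball ⊢
  rwa [hσt, norm_restrict_of_periodic hEf hRf hper]

/-- **THE LIPSCHITZ LETTER TRANSFERS WITH THE SAME CONSTANT** (PTC's carrier maps are isometries on periodic fields). [folklore] -/
theorem background_torus_lipschitz {K : ℝ≥0} (hlip : LipschitzOnWith K σ (closedBall (0 : lp (fun _ : X d => ℝ) ∞) R₀))
    (hperσ : ∀ w ∈ closedBall (0 : lp (fun _ : X d => ℝ) ∞) R₀, (∀ y t : X d, w (y + (s : ℤ) • t) = w y) →
      ∀ q t : X d, σ w (q + side n • ((s : ℤ) • t)) = σ w q)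
    (hEf : ∀ (g : Site d ((n + 1) * s) → ℝ) (q : X d), Ef g q = g (siteOf d ((n + 1) * s) q))
    (hRf : ∀ (h : lp (fun _ : X d => ℝ) ∞) (x : Site d ((n + 1) * s)), Rf h x = h (windowMap d ((n + 1) * s) x))
    (hEc : ∀ (g : Site d s → ℝ) (q : X d), Ec g q = g (siteOf d s q))
    (hσt : ∀ wt, σt wt = Rf (σ (Ec wt))) :
    LipschitzOnWith K σt (closedBall (0 : Site d s → ℝ) R₀) := by
  have hball : ∀ wt ∈ closedBall (0 : Site d s → ℝ) R₀, Ec wt ∈ closedBall (0 : lp (fun _ : X d => ℝ) ∞) R₀ :=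
    fun wt hwt => by
      rw [mem_closedBall_zero_iff] at hwt ⊢
      rwa [norm_periodise hEc]
  have hper : ∀ wt ∈ closedBall (0 : Site d s → ℝ) R₀, ∀ q t : X d,
      σ (Ec wt) (q + (((n + 1) * s : ℕ) : ℤ) • t) = σ (Ec wt) q := fun wt hwt q t => by
    rw [natCast_mul_smul_eq]; exact hperσ (Ec wt) (hball wt hwt) (periodise_periodic hEc wt) q t
  refine lipschitzOnWith_iff_dist_le_mul.2 fun wt hwt wt' hwt' => ?_
  have h := lipschitzOnWith_iff_dist_le_mul.1 hlip (Ec wt) (hball wt hwt) (Ec wt') (hball wt' hwt')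
  rw [dist_eq_norm, dist_eq_norm, ← map_sub, norm_periodise hEc] at h
  rw [dist_eq_norm, dist_eq_norm, hσt, hσt, ← map_sub,
    norm_restrict_of_periodic hEf hRf (sub_periodic (hper wt hwt) (hper wt' hwt'))]
  exact h

/-! ## §3. Uniqueness on the torus, from either `ℓ^∞` uniqueness letter -/

/-- **TORUS UNIQUENESS FROM (60)'s LETTER** (`σ(Q′φ) = φ` for every solution `φ` with `‖φ‖ ≤ r`): a torus field `φt`, `‖φt‖ ≤ r`, whose
periodisation solves the sitewise equation IS `σt` of its torus block means. [folklore] -/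
theorem torus_unique_of_section_letter
    (hD : ∀ (f : lp (fun _ : X d => ℝ) ∞) (y : X d), Dop f y = (((n : ℝ) + 1) ^ d)⁻¹ * ∑ p ∈ B n y, f p)
    (huniq : ∀ φ ∈ closedBall (0 : lp (fun _ : X d => ℝ) ∞) r,
      (∀ p : X d, Aop φ p + u (φ p) = (((n : ℝ) + 1) ^ d)⁻¹ * ∑ p' ∈ B n (blk n p), (Aop φ p' + u (φ p'))) →
        σ (Dop φ) = φ)
    (hEf : ∀ (g : Site d ((n + 1) * s) → ℝ) (q : X d), Ef g q = g (siteOf d ((n + 1) * s) q))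
    (hRf : ∀ (h : lp (fun _ : X d => ℝ) ∞) (x : Site d ((n + 1) * s)), Rf h x = h (windowMap d ((n + 1) * s) x))
    (hEc : ∀ (g : Site d s → ℝ) (q : X d), Ec g q = g (siteOf d s q))
    (hRc : ∀ (h : lp (fun _ : X d => ℝ) ∞) (x : Site d s), Rc h x = h (windowMap d s x))
    (hσt : ∀ wt, σt wt = Rf (σ (Ec wt)))
    (φt : Site d ((n + 1) * s) → ℝ) (hφt : φt ∈ closedBall (0 : Site d ((n + 1) * s) → ℝ) r)
    (heq : ∀ p : X d, Aop (Ef φt) p + u (Ef φt p)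
      = (((n : ℝ) + 1) ^ d)⁻¹ * ∑ p' ∈ B n (blk n p), (Aop (Ef φt) p' + u (Ef φt p'))) :
    σt (Rc (Dop (Ef φt))) = φt := by
  have hφ : Ef φt ∈ closedBall (0 : lp (fun _ : X d => ℝ) ∞) r := by
    rw [mem_closedBall_zero_iff] at hφt ⊢
    rwa [norm_periodise hEf]
  rw [hσt, periodise_restrict_of_periodic hEc hRc (blockAvg_periodise_periodic n s hD hEf φt), huniq (Ef φt) hφ heq,
    restrict_periodise hEf hRf]

/-- **TORUS UNIQUENESS FROM (74)'s LETTER** (two `ℓ^∞` solutions of the sitewise equation with the same block means are equal): a torus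
field whose periodisation solves the sitewise equation with block means `Ec wt`, `‖wt‖ ≤ R₀`, IS `σt wt`. [folklore] -/
theorem torus_unique_of_sitewise_letter
    (hσ : ∀ w ∈ closedBall (0 : lp (fun _ : X d => ℝ) ∞) R₀,
      σ w ∈ closedBall 0 r ∧ Dop (σ w) = w ∧
        ∀ p : X d, Aop (σ w) p + u (σ w p)
          = (((n : ℝ) + 1) ^ d)⁻¹ * ∑ p' ∈ B n (blk n p), (Aop (σ w) p' + u (σ w p')))
    (hES : ∀ φ ψ : lp (fun _ : X d => ℝ) ∞, Dop φ = Dop ψ →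
      (∀ p : X d, Aop φ p + u (φ p) = (((n : ℝ) + 1) ^ d)⁻¹ * ∑ p' ∈ B n (blk n p), (Aop φ p' + u (φ p'))) →
      (∀ p : X d, Aop ψ p + u (ψ p) = (((n : ℝ) + 1) ^ d)⁻¹ * ∑ p' ∈ B n (blk n p), (Aop ψ p' + u (ψ p'))) → φ = ψ)
    (hEf : ∀ (g : Site d ((n + 1) * s) → ℝ) (q : X d), Ef g q = g (siteOf d ((n + 1) * s) q))
    (hRf : ∀ (h : lp (fun _ : X d => ℝ) ∞) (x : Site d ((n + 1) * s)), Rf h x = h (windowMap d ((n + 1) * s) x))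
    (hEc : ∀ (g : Site d s → ℝ) (q : X d), Ec g q = g (siteOf d s q))
    (hσt : ∀ wt, σt wt = Rf (σ (Ec wt)))
    {wt : Site d s → ℝ} (hwt : wt ∈ closedBall (0 : Site d s → ℝ) R₀) (φt : Site d ((n + 1) * s) → ℝ)
    (hDφ : Dop (Ef φt) = Ec wt)
    (heq : ∀ p : X d, Aop (Ef φt) p + u (Ef φt p)
      = (((n : ℝ) + 1) ^ d)⁻¹ * ∑ p' ∈ B n (blk n p), (Aop (Ef φt) p' + u (Ef φt p'))) :
    σt wt = φt := by
  have hball : Ec wt ∈ closedBall (0 : lp (fun _ : X d => ℝ) ∞) R₀ := by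
    rw [mem_closedBall_zero_iff] at hwt ⊢
    rwa [norm_periodise hEc]
  obtain ⟨-, hDσ, hEq⟩ := hσ (Ec wt) hball
  rw [hσt, hES (σ (Ec wt)) (Ef φt) (by rw [hDσ, hDφ]) hEq heq, restrict_periodise hEf hRf]

end Generic

/-! ## §4. Instance: (60)'s background with (73)'s periodicity (uniqueness-based) on the torus carriers -/

/-- **THE SMALL-FIELD BACKGROUND ON EVERY TORUS** (`d ≥ 3`; (60)'s hypotheses verbatim; every coarse period `s ≥ 1`).  (60)'s
operators `Q′ ∕ A ∕ P` and background map `σ` with their displayed actions and letters (all of (60)'s, incl. the derivative clause), the PTC carrier maps `Ef ∕ Rf` (fine torus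
`Site d ((n+1)s)`) and `Ec ∕ Rc` (coarse torus `Site d s`), and the TORUS BACKGROUND `σt wt = Rf (σ (Ec wt))`: on the torus ball
`‖wt‖ ≤ (N⁻¹ − c)·r` it has `‖σt wt‖ ≤ r`, its periodisation IS `σ (Ec wt)` ((73): the background of a periodic coarse field is
periodic), so its torus block means are `wt` and the sitewise background equation holds; `σt` is `(N⁻¹ − c)⁻¹`-Lipschitz there (PTC's
isometries); and any torus field of norm `≤ r` whose periodisation solves the sitewise equation is `σt` of its block means. [folklore] -/
theorem exists_background_torus (hd : 3 ≤ d) (n : ℕ) {a : ℝ} (ha : 0 < a)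
    {u u' : ℝ → ℝ} (hu : ∀ t, HasDerivAt u (u' t) t) (hu0 : u 0 = 0) {lam c N : ℝ≥0} (hlam : ∀ t, |u' t| ≤ lam)
    {L : ℝ} (hL0 : 0 ≤ L) (hL : ∀ s t, |u' s - u' t| ≤ L * |s - t|)
    (hN : cHs d a * latticeConst d (deltaH d a)
        + ((cG0 d * cKL d (d - 2) + cSplit d a) * Real.exp (2 * deltaU d a)
            + cFar d a * Real.exp (4 * deltaU d a) / deltaU d a ^ 2) * latticeConst d (deltaU d a / 4)
          * (1 + cHs d a * latticeConst d (deltaH d a)) ≤ (N : ℝ))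
    (hc : 2 * lam ≤ c) (hcN : c < N⁻¹) {r : ℝ} (hr : 0 ≤ r) (s : ℕ) [NeZero s] :
    ∃ (Dop Aop Pop : lp (fun _ : X d => ℝ) ∞ →L[ℝ] lp (fun _ : X d => ℝ) ∞)
      (σ : lp (fun _ : X d => ℝ) ∞ → lp (fun _ : X d => ℝ) ∞)
      (Ef : (Site d ((n + 1) * s) → ℝ) →L[ℝ] lp (fun _ : X d => ℝ) ∞)
      (Rf : lp (fun _ : X d => ℝ) ∞ →L[ℝ] (Site d ((n + 1) * s) → ℝ))
      (Ec : (Site d s → ℝ) →L[ℝ] lp (fun _ : X d => ℝ) ∞)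
      (Rc : lp (fun _ : X d => ℝ) ∞ →L[ℝ] (Site d s → ℝ))
      (σt : (Site d s → ℝ) → (Site d ((n + 1) * s) → ℝ)),
      -- (60)'s displayed actions and letters, same witnesses
      (∀ (f : lp (fun _ : X d => ℝ) ∞) (y : X d), Dop f y = (((n : ℝ) + 1) ^ d)⁻¹ * ∑ p ∈ B n y, f p) ∧
      (∀ (f : lp (fun _ : X d => ℝ) ∞) (p : X d), Aop f p = ∑ r ∈ nbhd n p, AX n a p r * f r) ∧
      (∀ (f : lp (fun _ : X d => ℝ) ∞) (p : X d), Pop f p = f p - (((n : ℝ) + 1) ^ d)⁻¹ * ∑ p' ∈ B n (blk n p), f p') ∧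
      σ 0 = 0 ∧
      (∀ w ∈ closedBall (0 : lp (fun _ : X d => ℝ) ∞) (((N : ℝ)⁻¹ - c) * r),
        σ w ∈ closedBall 0 r ∧ Dop (σ w) = w ∧
          ∀ p : X d, Aop (σ w) p + u (σ w p)
            = (((n : ℝ) + 1) ^ d)⁻¹ * ∑ p' ∈ B n (blk n p), (Aop (σ w) p' + u (σ w p'))) ∧
      LipschitzOnWith (N⁻¹ - c)⁻¹ σ (closedBall (0 : lp (fun _ : X d => ℝ) ∞) (((N : ℝ)⁻¹ - c) * r)) ∧
      (∀ φ ∈ closedBall (0 : lp (fun _ : X d => ℝ) ∞) r,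
        (∀ p : X d, Aop φ p + u (φ p) = (((n : ℝ) + 1) ^ d)⁻¹ * ∑ p' ∈ B n (blk n p), (Aop φ p' + u (φ p'))) →
          σ (Dop φ) = φ) ∧
      (∀ w ∈ ball (0 : lp (fun _ : X d => ℝ) ∞) (((N : ℝ)⁻¹ - c) * r),
        DifferentiableAt ℝ σ w ∧ ‖fderiv ℝ σ w‖ ≤ ((N : ℝ)⁻¹ - c)⁻¹ ∧
          Dop.comp (fderiv ℝ σ w) = ContinuousLinearMap.id ℝ (lp (fun _ : X d => ℝ) ∞)) ∧
      -- the carrier maps (PTC), actions and laws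
      (∀ (g : Site d ((n + 1) * s) → ℝ) (q : X d), Ef g q = g (siteOf d ((n + 1) * s) q)) ∧
      (∀ (h : lp (fun _ : X d => ℝ) ∞) (x : Site d ((n + 1) * s)), Rf h x = h (windowMap d ((n + 1) * s) x)) ∧
      (∀ (g : Site d s → ℝ) (q : X d), Ec g q = g (siteOf d s q)) ∧
      (∀ (h : lp (fun _ : X d => ℝ) ∞) (x : Site d s), Rc h x = h (windowMap d s x)) ∧
      (∀ g, ‖Ef g‖ = ‖g‖) ∧ (∀ g, Rf (Ef g) = g) ∧ (∀ g, ‖Ec g‖ = ‖g‖) ∧ (∀ g, Rc (Ec g) = g) ∧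
      -- the torus background
      (∀ wt, σt wt = Rf (σ (Ec wt))) ∧ σt 0 = 0 ∧
      (∀ wt ∈ closedBall (0 : Site d s → ℝ) (((N : ℝ)⁻¹ - c) * r),
        σt wt ∈ closedBall 0 r ∧ Ef (σt wt) = σ (Ec wt) ∧ Dop (Ef (σt wt)) = Ec wt ∧ Rc (Dop (Ef (σt wt))) = wt ∧
          ∀ p : X d, Aop (Ef (σt wt)) p + u (Ef (σt wt) p)
            = (((n : ℝ) + 1) ^ d)⁻¹ * ∑ p' ∈ B n (blk n p), (Aop (Ef (σt wt)) p' + u (Ef (σt wt) p'))) ∧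
      LipschitzOnWith (N⁻¹ - c)⁻¹ σt (closedBall (0 : Site d s → ℝ) (((N : ℝ)⁻¹ - c) * r)) ∧
      (∀ φt ∈ closedBall (0 : Site d ((n + 1) * s) → ℝ) r,
        (∀ p : X d, Aop (Ef φt) p + u (Ef φt p)
            = (((n : ℝ) + 1) ^ d)⁻¹ * ∑ p' ∈ B n (blk n p), (Aop (Ef φt) p' + u (Ef φt p'))) →
          σt (Rc (Dop (Ef φt))) = φt) := by
  obtain ⟨Dop, Aop, Pop, σ, hD, hA, hP, hσ0, hσ, hlip, huniq, hderiv⟩ :=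
    exists_background hd n ha hu hu0 hlam hL0 hL hN hc hcN hr
  obtain ⟨Ef, hEf⟩ := exists_clm_periodise (d := d) ((n + 1) * s)
  obtain ⟨Rf, hRf, -⟩ := exists_clm_restrict (d := d) ((n + 1) * s)
  obtain ⟨Ec, hEc⟩ := exists_clm_periodise (d := d) s
  obtain ⟨Rc, hRc, -⟩ := exists_clm_restrict (d := d) s
  -- (73): the background of a periodic coarse field is periodic (uniqueness letter `huniq`)
  have hperσ : ∀ w ∈ closedBall (0 : lp (fun _ : X d => ℝ) ∞) (((N : ℝ)⁻¹ - c) * r),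
      (∀ y t : X d, w (y + (s : ℤ) • t) = w y) → ∀ q t : X d, σ w (q + side n • ((s : ℤ) • t)) = σ w q :=
    fun w hw hper q t => background_periodic_of_letters n Dop Aop hD hA hσ huniq s hw hper q t
  have hσt : ∀ wt : Site d s → ℝ, (fun wt => Rf (σ (Ec wt))) wt = Rf (σ (Ec wt)) := fun _ => rfl
  exact ⟨Dop, Aop, Pop, σ, Ef, Rf, Ec, Rc, fun wt => Rf (σ (Ec wt)), hD, hA, hP, hσ0, hσ, hlip, huniq, hderiv, hEf, hRf, hEc, hRc,
    norm_periodise hEf, restrict_periodise hEf hRf, norm_periodise hEc, restrict_periodise hEc hRc, hσt,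
    by beta_reduce; rw [map_zero, hσ0, map_zero],
    fun wt hwt => background_torus_of_letters hσ hperσ hEf hRf hEc hRc hσt wt hwt,
    background_torus_lipschitz hlip hperσ hEf hRf hEc hσt,
    fun φt hφt heq => torus_unique_of_section_letter hD huniq hEf hRf hEc hRc hσt φt hφt heq⟩

/-! ## §5. Toy -/

/-- Toy: `sub_periodic` at any period vector — the zero field minus itself is periodic. [folklore] -/
example (c q t : X d) : ((0 : lp (fun _ : X d => ℝ) ∞) - 0) (q + c • t) = ((0 : lp (fun _ : X d => ℝ) ∞) - 0) q :=
  sub_periodic (fun _ _ => rfl) (fun _ _ => rfl) q t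

end Summit.QuantumFields.BalabanUV.T4Continuum.NE7b.SupBackgroundTorusCarrier

end
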